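import Mathlib.Algebra.Order.Chebyshev
import Mathlib.Data.Real.Basic
import Mathlib.Data.Finset.Prod
import Mathlib.Algebra.Order.BigOperators.Group.Finset
import Mathlib.Tactic
import HarnessLib

/-!
# Route `GreenTaoLevelTwo`, crux `GITwo` (stmt-Parity-21275), line `birth`, stub `stub_cyclicInverse`:
# towards Balog–Szemerédi–Gowers — the dependent random choice (paths of length two) lemma

Fourth helper file toward the XL stub `stub_cyclicInverse` (B. Green, T. Tao, *An inverse theorem
for the Gowers `U³(G)` norm*, arXiv:math/0503014, Thm. 68 = PEMS 51 (2008) Thm. 12.8).  After Gowers'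
argument (`…CyclicInverseDerivatives`, `…CyclicInverseQuadruples`) the frequency graph has many
additive quadruples, and the printed proof invokes the **Balog–Szemerédi–Gowers theorem** (arXiv
Thm. 25) to pass to a large subset with small difference set.  Neither Mathlib nor the tree has BSG;
its standard proof (Gowers 1998 §7; Tao–Vu, *Additive Combinatorics*, §2.5 and Lemma 6.19;
Sudakov–Szemerédi–Vu 2005) starts with the graph-theoretic **dependent random choice / paths of
length two lemma**, which this def-free file lands for finite bipartite graphs given as a finset of
edges `E ⊆ A × B`:

* `sum_card_edgeFiber_eq_card` — `∑_{b ∈ B} deg(b) = #E` (edge fibres `{e ∈ E : e.2 = b}`);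
* `card_edgeFiber_eq_card_nbhd` — the edge fibre over `b` is in bijection with the neighbourhood
  `{a ∈ A : (a,b) ∈ E}`;
* `sum_card_badPairs_le` — double counting of the pairs of edges through a common `b` whose first
  coordinates have few common neighbours: `∑_b #bad(b) ≤ γ #B · #A²`;
* `exists_vertex_many_rich_pairs` — **dependent random choice**: if `#E ≥ #A·#B/K` then some
  `b ∈ B` has `deg(b)² ≥ #A²/(2K²)` and at most `ε·deg(b)²` ordered pairs of its neighbours with
  fewer than `(ε/(2K²))·#B` common neighbours.

Next files (not here): paths of length three, and the BSG assembly via popular differences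
(arXiv Thm. 25 with polynomial constants), then arXiv Prop. 27.

References: [GreenTao2008U3Inverse] arXiv:math/0503014 Thm. 25 (quoted from Chang / Gowers);
W. T. Gowers, GAFA 8 (1998) 529–551, §7; T. Tao, V. Vu, *Additive Combinatorics* (CUP 2006), §2.5, §6.4.
-/

namespace Summit.Parity.GeneralizedHardyLittlewood.GreenTaoLevelTwoGITwoCyclicInverse

open Finset

variable {α β : Type*} [DecidableEq α] [DecidableEq β]

omit [DecidableEq α] in
/-- Degree sum formula for a bipartite edge set: `∑_{b ∈ B} #{e ∈ E : e.2 = b} = #E` when every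
edge has its second vertex in `B`. [folklore] -/
theorem sum_card_edgeFiber_eq_card (B : Finset β) (E : Finset (α × β)) (hE : ∀ e ∈ E, e.2 ∈ B) :
    ∑ b ∈ B, #{e ∈ E | e.2 = b} = #E :=
  (Finset.card_eq_sum_card_fiberwise hE).symm

/-- The edge fibre over `b` is in bijection with the neighbourhood of `b` in `A`. [folklore] -/
theorem card_edgeFiber_eq_card_nbhd (A : Finset α) (E : Finset (α × β)) (hE : ∀ e ∈ E, e.1 ∈ A)
    (b : β) : #{e ∈ E | e.2 = b} = #{a ∈ A | (a, b) ∈ E} := by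
  refine Finset.card_nbij' (fun e => e.1) (fun a => (a, b)) ?_ ?_ ?_ ?_
  · intro e he
    simp only [mem_coe, mem_filter] at he ⊢
    refine ⟨hE e he.1, ?_⟩
    have : e = (e.1, b) := by rw [← he.2]
    rw [← this]
    exact he.1
  · intro a ha
    simp only [mem_coe, mem_filter] at ha ⊢
    exact ⟨ha.2, by simp⟩
  · intro e he
    simp only [mem_coe, mem_filter] at he
    exact Prod.ext rfl he.2.symm
  · intro a _
    rfl

omit [DecidableEq α] in
/-- Pairs of edges through a common second vertex, regrouped along that vertex:
`∑_{b ∈ B} #{(e,e') ∈ E_b × E_b : P(e,e')} = #{(e,e') ∈ E × E : e.2 = e'.2 ∧ P(e,e')}`. [folklore] -/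
theorem sum_card_pairs_edgeFiber_eq (B : Finset β) (E : Finset (α × β)) (hE : ∀ e ∈ E, e.2 ∈ B)
    (P : (α × β) × (α × β) → Prop) [DecidablePred P] :
    ∑ b ∈ B, #{q ∈ {e ∈ E | e.2 = b} ×ˢ {e ∈ E | e.2 = b} | P q} =
      #{q ∈ E ×ˢ E | q.1.2 = q.2.2 ∧ P q} := by
  rw [Finset.card_eq_sum_card_fiberwise (f := fun q : (α × β) × (α × β) => q.1.2) (t := B)
    (fun q hq => hE q.1 (mem_product.mp (mem_filter.mp hq).1).1)]
  refine Finset.sum_congr rfl fun b _ => ?_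
  congr 1
  ext q
  simp only [mem_filter, mem_product]
  constructor
  · rintro ⟨⟨⟨h1, h2⟩, h3, h4⟩, h5⟩
    exact ⟨⟨⟨h1, h3⟩, by rw [h2, h4], h5⟩, h2⟩
  · rintro ⟨⟨⟨h1, h3⟩, h24, h5⟩, h2⟩
    exact ⟨⟨⟨h1, h2⟩, h3, by rw [← h24, h2]⟩, h5⟩

/-- **Double counting of poor pairs.** Call an ordered pair `(a,a')` poor if it has fewer than
`γ·#B` common neighbours `b' ∈ B`.  The number of pairs of edges `((a,b),(a',b))` through a common
vertex with `(a,a')` poor is at most `γ #B · #A²` (`γ ≥ 0`). [folklore] -/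
theorem card_poorEdgePairs_le (A : Finset α) (B : Finset β) (E : Finset (α × β))
    (hEA : ∀ e ∈ E, e.1 ∈ A) (hEB : ∀ e ∈ E, e.2 ∈ B) {γ : ℝ} (hγ : 0 ≤ γ) :
    (#{q ∈ E ×ˢ E | q.1.2 = q.2.2 ∧
        (#{b' ∈ B | (q.1.1, b') ∈ E ∧ (q.2.1, b') ∈ E} : ℝ) < γ * #B} : ℝ) ≤
      γ * #B * ((#A : ℝ) * #A) := by
  set s : Finset ((α × β) × (α × β)) := {q ∈ E ×ˢ E | q.1.2 = q.2.2 ∧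
    (#{b' ∈ B | (q.1.1, b') ∈ E ∧ (q.2.1, b') ∈ E} : ℝ) < γ * #B} with hs
  have hmaps : ∀ q ∈ s, (fun q : (α × β) × (α × β) => (q.1.1, q.2.1)) q ∈ A ×ˢ A := by
    intro q hq
    have hq' := (mem_filter.mp hq).1
    rw [mem_product] at hq' ⊢
    exact ⟨hEA _ hq'.1, hEA _ hq'.2⟩
  rw [Finset.card_eq_sum_card_fiberwise hmaps]
  push_cast
  have hfib : ∀ p ∈ A ×ˢ A, (#{q ∈ s | (q.1.1, q.2.1) = p} : ℝ) ≤ γ * #B := by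
    intro p _
    -- the fibre injects into the common neighbourhood of `p`
    have hinj : #{q ∈ s | (q.1.1, q.2.1) = p} ≤ #{b' ∈ B | (p.1, b') ∈ E ∧ (p.2, b') ∈ E} := by
      refine Finset.card_le_card_of_injOn (fun q => q.1.2) ?_ ?_
      · intro q hq
        rw [mem_coe, mem_filter] at hq
        obtain ⟨hqs, hqp⟩ := hq
        rw [hs, mem_filter, mem_product] at hqs
        obtain ⟨⟨h1, h2⟩, h3, -⟩ := hqs
        have e1 : q.1.1 = p.1 := congrArg Prod.fst hqp
        have e2 : q.2.1 = p.2 := congrArg Prod.snd hqp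
        rw [mem_coe, mem_filter]
        refine ⟨hEB _ h1, ?_, ?_⟩
        · show (p.1, q.1.2) ∈ E
          rw [← e1]; exact h1
        · show (p.2, q.1.2) ∈ E
          rw [← e2, h3]; exact h2
      · intro q hq q' hq' heq
        rw [mem_coe, mem_filter] at hq hq'
        obtain ⟨hqs, hqp⟩ := hq
        obtain ⟨hqs', hqp'⟩ := hq'
        rw [hs, mem_filter] at hqs hqs'
        have h3 : q.1.2 = q.2.2 := hqs.2.1
        have h3' : q'.1.2 = q'.2.2 := hqs'.2.1
        have e1 : q.1.1 = q'.1.1 :=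
          (congrArg Prod.fst hqp : q.1.1 = p.1).trans (congrArg Prod.fst hqp' : q'.1.1 = p.1).symm
        have e2 : q.2.1 = q'.2.1 :=
          (congrArg Prod.snd hqp : q.2.1 = p.2).trans (congrArg Prod.snd hqp' : q'.2.1 = p.2).symm
        have heq' : q.1.2 = q'.1.2 := heq
        exact Prod.ext (Prod.ext e1 heq') (Prod.ext e2 (by rw [← h3, heq', h3']))
    rcases ({q ∈ s | (q.1.1, q.2.1) = p} : Finset _).eq_empty_or_nonempty with h0 | ⟨q, hq⟩
    · rw [h0, card_empty, Nat.cast_zero]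
      positivity
    · rw [mem_filter] at hq
      obtain ⟨hqs, hqp⟩ := hq
      rw [hs, mem_filter] at hqs
      have hpoor := hqs.2.2
      have e1 : q.1.1 = p.1 := congrArg Prod.fst hqp
      have e2 : q.2.1 = p.2 := congrArg Prod.snd hqp
      rw [e1, e2] at hpoor
      calc (#{q ∈ s | (q.1.1, q.2.1) = p} : ℝ)
          ≤ #{b' ∈ B | (p.1, b') ∈ E ∧ (p.2, b') ∈ E} := by exact_mod_cast hinj
        _ ≤ γ * #B := hpoor.le
  calc ∑ p ∈ A ×ˢ A, (#{q ∈ s | (q.1.1, q.2.1) = p} : ℝ) ≤ ∑ _p ∈ A ×ˢ A, γ * #B :=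
        sum_le_sum hfib
    _ = γ * #B * ((#A : ℝ) * #A) := by rw [sum_const, card_product, nsmul_eq_mul]; push_cast; ring

/-- **Dependent random choice (paths of length two).** Let `E ⊆ A × B` be a bipartite edge set with
`#E ≥ #A·#B/K`, and let `ε > 0`.  Then some vertex `b ∈ B` has degree `deg(b)` with
`deg(b)² ≥ (#A)²/(2K²)`, and among the `deg(b)²` ordered pairs of edges at `b` at most `ε·deg(b)²`
join vertices `a, a'` with fewer than `(ε/(2K²))·#B` common neighbours.  (Average over `b ∈ B` of
`deg(b)² − ε⁻¹·#poor(b)`, Cauchy–Schwarz for `∑ deg(b)²`, and `card_poorEdgePairs_le`.)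
[cite: GreenTao2008U3Inverse, Thm. 25 (first step of the proof of Balog–Szemerédi–Gowers)] -/
theorem exists_vertex_many_rich_pairs (A : Finset α) (B : Finset β) (E : Finset (α × β))
    (hEA : ∀ e ∈ E, e.1 ∈ A) (hEB : ∀ e ∈ E, e.2 ∈ B) (hB : B.Nonempty) {K ε : ℝ} (hK : 0 < K)
    (hε : 0 < ε) (hcard : (#A : ℝ) * #B / K ≤ #E) :
    ∃ b ∈ B, (#A : ℝ) ^ 2 / (2 * K ^ 2) ≤ (#{e ∈ E | e.2 = b} : ℝ) ^ 2 ∧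
      (#{q ∈ {e ∈ E | e.2 = b} ×ˢ {e ∈ E | e.2 = b} |
          (#{b' ∈ B | (q.1.1, b') ∈ E ∧ (q.2.1, b') ∈ E} : ℝ) < ε / (2 * K ^ 2) * #B} : ℝ) ≤
        ε * (#{e ∈ E | e.2 = b} : ℝ) ^ 2 := by
  have hBpos : (0 : ℝ) < #B := by exact_mod_cast hB.card_pos
  have hγ0 : 0 ≤ ε / (2 * K ^ 2) := by positivity
  obtain ⟨deg, hdeg⟩ : ∃ deg : β → ℝ, ∀ b, deg b = (#{e ∈ E | e.2 = b} : ℝ) := ⟨_, fun _ => rfl⟩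
  obtain ⟨bad, hbad⟩ : ∃ bad : β → ℝ, ∀ b, bad b =
      (#{q ∈ {e ∈ E | e.2 = b} ×ˢ {e ∈ E | e.2 = b} |
          (#{b' ∈ B | (q.1.1, b') ∈ E ∧ (q.2.1, b') ∈ E} : ℝ) < ε / (2 * K ^ 2) * #B} : ℝ) :=
    ⟨_, fun _ => rfl⟩
  -- (1) degree sum
  have h1 : ∑ b ∈ B, deg b = #E := by
    simp_rw [hdeg]
    exact_mod_cast sum_card_edgeFiber_eq_card B E hEB
  -- (2) Cauchy–Schwarz
  have h2 : (#A : ℝ) ^ 2 * #B / K ^ 2 ≤ ∑ b ∈ B, deg b ^ 2 := by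
    have hcs := sq_sum_le_card_mul_sum_sq (s := B) (f := deg)
    rw [h1] at hcs
    have h3 : ((#A : ℝ) * #B / K) ^ 2 ≤ (#E : ℝ) ^ 2 := pow_le_pow_left₀ (by positivity) hcard 2
    have h5 : (#A : ℝ) ^ 2 * #B / K ^ 2 * #B ≤ (∑ b ∈ B, deg b ^ 2) * #B :=
      calc (#A : ℝ) ^ 2 * #B / K ^ 2 * #B = ((#A : ℝ) * #B / K) ^ 2 := by ring
        _ ≤ (#E : ℝ) ^ 2 := h3
        _ ≤ #B * ∑ b ∈ B, deg b ^ 2 := hcs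
        _ = (∑ b ∈ B, deg b ^ 2) * #B := mul_comm _ _
    exact le_of_mul_le_mul_right h5 hBpos
  -- (3) poor pairs
  have h6 : ∑ b ∈ B, bad b ≤ ε / (2 * K ^ 2) * #B * ((#A : ℝ) * #A) := by
    simp_rw [hbad]
    have h := sum_card_pairs_edgeFiber_eq B E hEB
      (fun q => (#{b' ∈ B | (q.1.1, b') ∈ E ∧ (q.2.1, b') ∈ E} : ℝ) < ε / (2 * K ^ 2) * #B)
    calc _ = (#{q ∈ E ×ˢ E | q.1.2 = q.2.2 ∧
          (#{b' ∈ B | (q.1.1, b') ∈ E ∧ (q.2.1, b') ∈ E} : ℝ) < ε / (2 * K ^ 2) * #B} : ℝ) := by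
          exact_mod_cast h
      _ ≤ _ := card_poorEdgePairs_le A B E hEA hEB hγ0
  -- (4) averaging
  have h7 : ∑ _b ∈ B, (#A : ℝ) ^ 2 / (2 * K ^ 2) ≤ ∑ b ∈ B, (deg b ^ 2 - bad b / ε) := by
    rw [sum_const, nsmul_eq_mul, sum_sub_distrib, ← Finset.sum_div]
    have h8 : (∑ b ∈ B, bad b) / ε ≤ (#A : ℝ) ^ 2 * #B / (2 * K ^ 2) := by
      rw [div_le_iff₀ hε]
      calc ∑ b ∈ B, bad b ≤ ε / (2 * K ^ 2) * #B * ((#A : ℝ) * #A) := h6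
        _ = (#A : ℝ) ^ 2 * #B / (2 * K ^ 2) * ε := by ring
    have h9 : (#B : ℝ) * ((#A : ℝ) ^ 2 / (2 * K ^ 2)) =
        (#A : ℝ) ^ 2 * #B / K ^ 2 - (#A : ℝ) ^ 2 * #B / (2 * K ^ 2) := by ring
    rw [h9]
    linarith
  obtain ⟨b, hbB, hb⟩ := Finset.exists_le_of_sum_le hB h7
  have hbad0 : 0 ≤ bad b := by rw [hbad]; positivity
  refine ⟨b, hbB, ?_, ?_⟩
  · rw [← hdeg]
    have : 0 ≤ bad b / ε := div_nonneg hbad0 hε.le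
    linarith
  · rw [← hdeg, ← hbad]
    have hA0 : 0 ≤ (#A : ℝ) ^ 2 / (2 * K ^ 2) := by positivity
    have : bad b / ε ≤ deg b ^ 2 := by linarith
    rwa [div_le_iff₀ hε, mul_comm] at this

end Summit.Parity.GeneralizedHardyLittlewood.GreenTaoLevelTwoGITwoCyclicInverse
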